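import Mathlib
import Summits.KontsevichZagierPeriods.Zeta5Search.WellPoisedFaceZeta57
import HarnessLib.Audit
import HarnessLib

/-!
# The numerator-free face of Zudilin's `r = 3` boxes for the window `{ζ(5), ζ(7), ζ(9)}` (`q = 10, 11`):
# an `η₄`-COUPLED Gibbs-tangent envelope and the Proposition-5 NO-GO at every height for all `q ≤ 11`
# — cell `pub-zeta5`, class `odd` (gen 7), target T4 (structural no-go serving T2)

HONEST FRAMING: systematic search; no irrationality claim unless certified.  This file proves a NEGATIVE
(an envelope inequality on a whole face of a printed construction), not a candidate.

Provenance: family-designer seat `pub-zeta5-fam-odd-g7` (planner role; staged under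
`run/shared/lean/pub/pub-zeta5/lean/fam-odd/`, result of record `families/odd/FAMILY.md` §5.11, census item R10)
for VERBATIM filing by the lane.  Not literature.  It extends the tree theorem
`WellPoisedFace.FaceDirM.face_noGo` (`WellPoisedFaceZeta57`, class `odd` gen 5: `M ≤ 4`, i.e. `q ≤ 9`, windows
`{ζ(5)}`, `{ζ(5), ζ(7)}`) to `M ≤ 6`, i.e. `q ≤ 11` — EVERY window strictly inside Zudilin's proved one
`{ζ(5), ζ(7), ζ(9), ζ(11)}` (`q = 13`, Theorem 3) — which that file records as out of reach of its DECOUPLED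
constants ("the constant scheme stops exactly at `M log(4/3) < 2 − log 2`"; float decoupled margins `+0.144`
at `M = 5` and `−0.107` at `M = 6`).

## Source (PRINTED)
W. Zudilin, *Arithmetic of linear forms involving odd zeta values*, J. Théor. Nombres Bordeaux 16 (2004)
251–291 = arXiv:math/0206176, §8 [cite: Zudilin2004, §8: (8.6)–(8.9), Lemma 19, (8.13), Lemma 20, Prop. 5].
Dictionary, objects and the meaning of `C0 / delta / phiPlus / mOf` exactly as in `WellPoisedFaceZeta57`
(module docstring there); windows `q = 10, 11 ↦ {ζ(5), ζ(7), ζ(9)}` (`q = 10` is the class-`odd` parity variant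
of Lemma 19, as `q = 8` was; the inequality is parity-blind).

## The new input: COUPLING through `η₄`
`δ − φ⁺ − C₀ = [3m(a) − (η₀−2a) − g(a)] + Σ_j [m(mid_j) − (η₀−2mid_j) − g(mid_j)] + [m(d) − g(d)]` with
`m(x) = max{0, η₀ − 2a, η₀ − x}` VERBATIM (`FaceDirM.mOf`), `a = η₄` the smallest tail.  The gen-5 file used only
`m(x) ≥ η₀ − x` and bounded the three rôles by three INDEPENDENT suprema.  Here (`coupled_mid`): for ONE Gibbs
tangent `(s, t)` with `σ := 1 − log((s+t)/s) + 2 log((s+t)/t) ≥ 0` and every middle tail `mid ≥ a`,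
`max{η₀ − 2a, η₀ − mid} − (η₀ − 2mid) − g(mid) ≥ a·σ − η₀·log((s+t)/t)` (case `mid ≤ 2a`: use `η₀ − mid`; case
`mid ≥ 2a`: use `η₀ − 2a`), and the SAME tangent on the first tail gives `2η₀ − a − g(a) ≥ η₀(2 − λ) − a(2 − σ)`
(`λ := log((s+t)/t)`), so the `a`-coefficients COMBINE to `a·((M+1)σ − 2) ≥ 0` as soon as `(M+1)σ ≥ 2`:
**`face_gap_coupled` : `C₀ + (3 − (M+1)·λ − log(49/22))·η₀ ≤ δ − φ⁺`** for every `M` and every tangent with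
`(M+1)σ ≥ 2` (the top tail is bounded by the sharper decoupled tangent `(27, 22)`: `g(d) + d ≤ log(49/22)·η₀`,
`blockRate_add_le_sharp`, float sup `0.79880`, constant `0.80078`).  This is the float one-variable reduction of
FAMILY.md §5.11 (all middle tails collapse onto `η₄`) turned into a proof WITHOUT calculus: the tangent lines
`a ↦ aσ − η₀λ` are exactly the supporting lines of the convex function `a ↦ a − g(a)`.
## Results (complete proofs; certified decimal constants by `exp`-Taylor partial sums and `exp 1 < 2.7182818286`)
* `coupled_mid`; `blockRate_add_le_sharp` (`g + η ≤ log(49/22)·η₀`); certified logs `log_div_49_36_le`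
  (`≤ 37/120`), `log_div_49_22_le` (`≤ 0.801`), `log_seven_fifths_le` (`≤ 0.337`), `one_add_log_le_two_log`
  (`1 + log(49/27) ≤ 2 log(49/22)`), tangent admissibility `sigma_two_five` (`M = 5`: `(s,t) = (2,5)`,
  `6σ ≥ 2 ⟸ (25/14)^6 ≤ e^4`), `sigma_13_36` (`M = 6`: `(s,t) = (13,36)`, `7σ ≥ 2 ⟸ (1296/637)^7 ≤ e^5`).
* `FaceDirM.face_gap_coupled` (every `M`, every admissible tangent); `face_gap_five` : `C₀ + (3 − 6 log(7/5) −
  log(49/22))·η₀ ≤ δ − φ⁺` (constant `0.1804`; best admissible tangent `0.294`, true face minimum `0.296`);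
  `face_gap_six` : `C₀ + (3 − 7 log(49/36) − log(49/22))·η₀ ≤ δ − φ⁺` (constant `0.04111`,
  certified `≥ 0.0406`; true face minimum of `(δ − φ⁺ − C₀)/η₀` is `0.049` at `a = mid_j = 0.21η₀`,
  `d = 0.355η₀` — the coupled bound recovers it up to the `(27,22)` top-tail slack `0.002` and tangent mismatch).
* **`FaceDirM.face_gap_le_six` (`M ≤ 6`): `C₀ + η₀/25 ≤ δ − φ⁺`** (uniform constant `1/25`, from `gapConst_pos`
  of the gen-5 file for `M ≤ 4` and the two new constants); **`face_noGo_le_six` (`M ≤ 6`, i.e. `q ≤ 11`): for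
  every `φ ≤ φ⁺`, `C₀ < δ − φ`** — Proposition 5's hypothesis `C₀ > C₂` FAILS at every direction of the
  numerator-free face of EVERY box `q ≤ 11`, i.e. for every window `{ζ(5)}`, `{ζ(5),ζ(7)}`, `{ζ(5),ζ(7),ζ(9)}`
  strictly inside Zudilin's theorem, at every height; `face_forms_grow_le_six`, `face_kappa_lt_one_le_six`.
* SHARPNESS OF THE METHOD (float, docstring only): at `M = 7` (`q = 12`) the same one-variable reduction gives
  `min (δ − φ⁺ − C₀)/η₀ = −0.199 < 0` (at `a = mid = 0.20η₀`), and at `q = 13` the crude face ratio reaches `1.11`: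
  the envelope `C₀ < δ − φ⁺` is a theorem EXACTLY for the windows that are still open.
* Kernel instance `modelFace11` = `(200; 0³, 42, 43, 44, 45, 46, 47, 48, 71)` (`M = 6`, near the float arg-min
  shape): `φ⁺ = 770`, `δ = 1530`, and `face_noGo_le_six` applies.
## What is NOT proved here (paper / MODEL / float; FAMILY.md §5.11)
(i) the boundary lemma `C₀ = C0` (meaning of `C0`; for `q = 7` it is fam-vwp's kernel programme
`WellPoisedFaceBoundaryRate/Convexity/Sandwich`, Fin 4); (ii) `φ ≤ φ⁺` is the gen-6 kernel statement
`IntFaceDir.log_facePhi_eventually_le` (file `WellPoisedFaceOddGrowth`, any `M`) — with it and this file's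
`face_gap_le_six`, `IntFaceDir.faceLambda_eventually_ge` gives the growth of the normalised forms for `M ≤ 6`
under the decay floor (corollary staged separately, after that file lands); (iii) anything off the face (interior
MODEL sups `κ₉ = 0.5960`, `κ₁₁ = 0.8582`, `zeta5-calc/odd/SUPKAPPA.md`, are CERTIFIED-MODEL numerics, < 1 but not
theorems); (iv) Lemma 19 membership (PRINTED).  Nothing here is an irrationality claim; forms that grow prove
nothing about `ζ(5), ζ(7), ζ(9)`.
-/

noncomputable section

open Real Finset

namespace Summit.KontsevichZagierPeriods.Zeta5Search

namespace WellPoisedFace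

/-! ### 1. Certified logarithms (exp-Taylor partial sums `Σ_{i<N} x^i/i! ≤ exp x`) -/

/-- `log(49/36) ≤ 37/120 = 0.30833…` (float `0.308301`): `49/36 ≤ Σ_{i<6} x^i/i!` at `x = 37/120`. -/
theorem log_div_49_36_le : log (49 / 36 : ℝ) ≤ 37 / 120 := by
  rw [Real.log_le_iff_le_exp (by norm_num)]
  have h := Real.sum_le_exp_of_nonneg (show (0 : ℝ) ≤ 37 / 120 by norm_num) 6
  norm_num [Finset.sum_range_succ, Nat.factorial] at h
  linarith

/-- `log(49/22) ≤ 0.801` (float `0.800778`): `49/22 ≤ Σ_{i<8} x^i/i!` at `x = 801/1000`. -/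
theorem log_div_49_22_le : log (49 / 22 : ℝ) ≤ 801 / 1000 := by
  rw [Real.log_le_iff_le_exp (by norm_num)]
  have h := Real.sum_le_exp_of_nonneg (show (0 : ℝ) ≤ 801 / 1000 by norm_num) 8
  norm_num [Finset.sum_range_succ, Nat.factorial] at h
  linarith

/-- `log(7/5) ≤ 0.337` (float `0.336472`): `7/5 ≤ Σ_{i<7} x^i/i!` at `x = 337/1000`. -/
theorem log_seven_fifths_le : log (7 / 5 : ℝ) ≤ 337 / 1000 := by
  rw [Real.log_le_iff_le_exp (by norm_num)]
  have h := Real.sum_le_exp_of_nonneg (show (0 : ℝ) ≤ 337 / 1000 by norm_num) 7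
  norm_num [Finset.sum_range_succ, Nat.factorial] at h
  linarith

/-- The top-tail tangent `(s,t) = (27,22)` has non-positive `η`-coefficient: `1 + log(49/27) ≤ 2 log(49/22)`,
i.e. `e·49/27 ≤ (49/22)²` (`e < 2.7182818286` and `2.7182818286·49·484 ≤ 27·2401`). -/
theorem one_add_log_le_two_log : 1 + log (49 / 27 : ℝ) ≤ 2 * log (49 / 22) := by
  have he := Real.exp_one_lt_d9
  have key : Real.exp 1 * (49 / 27 : ℝ) ≤ (49 / 22) ^ 2 := by
    norm_num at he ⊢
    nlinarith
  have hlog := Real.log_le_log (by positivity) key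
  rw [Real.log_mul (Real.exp_pos 1).ne' (by norm_num), Real.log_exp, Real.log_pow] at hlog
  push_cast at hlog
  linarith

/-- Tangent admissibility for `M = 5`, `(s,t) = (2,5)` (tangent point `η = 2η₀/9`):
`2 ≤ 6·(1 − log(7/2) + 2 log(7/5))`, i.e. `6 log(7/2) ≤ 4 + 12 log(7/5)`, i.e. `(25/14)^6 = 32.4 ≤ e^4 = 54.6`
(`Σ_{i<6} 4^i/i! = 42.87`). -/
theorem sigma_two_five : 2 ≤ ((5 : ℕ) + 1 : ℝ) * (1 - log ((2 + 5) / 2) + 2 * log ((2 + 5) / 5)) := by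
  have h4 := Real.sum_le_exp_of_nonneg (show (0 : ℝ) ≤ 4 by norm_num) 6
  norm_num [Finset.sum_range_succ, Nat.factorial] at h4
  have key : ((2 + 5) / 2 : ℝ) ^ 6 ≤ Real.exp 4 * (((2 + 5) / 5) ^ 6) ^ 2 := by
    norm_num at h4 ⊢
    nlinarith
  have hlog := Real.log_le_log (by positivity) key
  rw [Real.log_mul (Real.exp_pos 4).ne' (by positivity), Real.log_exp, Real.log_pow, Real.log_pow,
    Real.log_pow] at hlog
  push_cast at hlog ⊢
  linarith

/-- Tangent admissibility for `M = 6`, `(s,t) = (13,36)` (tangent point `η = 13η₀/62 = 0.2097η₀`, next to the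
float arg-min `0.21η₀` of the face): `2 ≤ 7·(1 − log(49/13) + 2 log(49/36))`, i.e. `7 log(49/13) ≤ 5 + 14 log(49/36)`,
i.e. `(1296/637)^7 = 144.30 ≤ e^5 = 148.4` (`Σ_{i<11} 5^i/i! = 146.38`; float `7σ − 2 = 0.028`). -/
theorem sigma_13_36 : 2 ≤ ((6 : ℕ) + 1 : ℝ) * (1 - log ((13 + 36) / 13) + 2 * log ((13 + 36) / 36)) := by
  have h5 := Real.sum_le_exp_of_nonneg (show (0 : ℝ) ≤ 5 by norm_num) 11
  norm_num [Finset.sum_range_succ, Nat.factorial] at h5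
  have key : ((13 + 36) / 13 : ℝ) ^ 7 ≤ Real.exp 5 * (((13 + 36) / 36) ^ 7) ^ 2 := by
    norm_num at h5 ⊢
    nlinarith
  have hlog := Real.log_le_log (by positivity) key
  rw [Real.log_mul (Real.exp_pos 5).ne' (by positivity), Real.log_exp, Real.log_pow, Real.log_pow,
    Real.log_pow] at hlog
  push_cast at hlog ⊢
  linarith

/-! ### 2. The sharp top-tail tangent and the `η₄`-coupled middle-tail bound -/

/-- **Top tail, sharpened.** `g(η₀, η) + η ≤ log(49/22)·η₀` (Gibbs tangent `(27,22)`, coefficient of `η` is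
`1 + log(49/27) − 2 log(49/22) ≤ 0`).  Float: `sup (g(1,x) + x) = 0.79880` (`x = 0.35490`), constant `0.80078`
(the gen-5 bound `blockRate_add_le` has `(1 + log 2)/2 = 0.84657`). -/
theorem blockRate_add_le_sharp {η₀ η : ℝ} (hη : 0 ≤ η) (h2 : 2 * η < η₀) :
    blockRate η₀ η + η ≤ log (49 / 22) * η₀ := by
  have h := blockRate_le_tangent hη h2 (s := 27) (t := 22) (by norm_num) (by norm_num)
  rw [show ((27 : ℝ) + 22) / 27 = 49 / 27 by norm_num, show ((27 : ℝ) + 22) / 22 = 49 / 22 by norm_num] at h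
  have hc := one_add_log_le_two_log
  have hX : 0 ≤ η * (2 * log (49 / 22) - 1 - log (49 / 27)) := mul_nonneg hη (by linarith)
  nlinarith [hX, h]

/-- **The `η₄`-COUPLED middle-tail bound.** For `0 ≤ a ≤ m`, `2m < η₀` and a Gibbs tangent `(s,t)` with
`σ := 1 − log((s+t)/s) + 2 log((s+t)/t) ≥ 0`:
`a·σ − η₀·log((s+t)/t) ≤ max{η₀ − 2a, η₀ − m} − (η₀ − 2m) − g(η₀, m)`.
(The left side, as a function of `a`, is the tangent line of the convex `a ↦ a − g(η₀,a)` at `a/(η₀−a) = s/(s+t)`;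
case `m ≤ 2a` uses `η₀ − m`, case `m ≥ 2a` uses `η₀ − 2a`.) -/
theorem coupled_mid {η₀ a m s t : ℝ} (ha : 0 ≤ a) (ham : a ≤ m) (h2 : 2 * m < η₀) (hs : 0 < s) (ht : 0 < t)
    (hσ : 0 ≤ 1 - log ((s + t) / s) + 2 * log ((s + t) / t)) :
    a * (1 - log ((s + t) / s) + 2 * log ((s + t) / t)) - η₀ * log ((s + t) / t)
      ≤ max (η₀ - 2 * a) (η₀ - m) - (η₀ - 2 * m) - blockRate η₀ m := by
  obtain ⟨L, hL⟩ : ∃ L : ℝ, L = log ((s + t) / s) := ⟨_, rfl⟩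
  obtain ⟨lam, hlam⟩ : ∃ lam : ℝ, lam = log ((s + t) / t) := ⟨_, rfl⟩
  have hg := blockRate_le_tangent (ha.trans ham) h2 hs ht
  rw [← hL, ← hlam] at hg ⊢
  rw [← hL, ← hlam] at hσ
  rcases le_or_gt m (2 * a) with hm | hm
  · have hmax : η₀ - m ≤ max (η₀ - 2 * a) (η₀ - m) := le_max_right _ _
    have h1 : a * (1 - L + 2 * lam) ≤ m * (1 - L + 2 * lam) := mul_le_mul_of_nonneg_right ham hσ
    nlinarith [hmax, h1, hg]
  · have hmax : η₀ - 2 * a ≤ max (η₀ - 2 * a) (η₀ - m) := le_max_left _ _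
    have h1 : 2 * a * (2 - L + 2 * lam) ≤ m * (2 - L + 2 * lam) :=
      mul_le_mul_of_nonneg_right hm.le (by linarith)
    have h2' : 0 ≤ a * (1 - L + 2 * lam) := mul_nonneg ha hσ
    nlinarith [hmax, h1, hg, h2']

/-! ### 3. The coupled face envelope for `B = M + 2` pole bricks and the no-go for `M ≤ 6` (`q ≤ 11`) -/

namespace FaceDirM

variable {M : ℕ} (D : FaceDirM M)

/-- `η₀ − 2a ≤ mOf x` (the `η₄`-part of Zudilin's `m_j`, unused in the gen-5 file). -/
lemma mOf_ge_two_a (x : ℝ) : D.η₀ - 2 * D.a ≤ D.mOf x :=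
  le_trans (le_max_right _ _) (le_max_left _ _)

/-- `max{η₀ − 2a, η₀ − x} ≤ mOf x`. -/
lemma max_le_mOf (x : ℝ) : max (D.η₀ - 2 * D.a) (D.η₀ - x) ≤ D.mOf x :=
  max_le (D.mOf_ge_two_a x) (D.mOf_ge x)

/-- **COUPLED FACE ENVELOPE (PROVED, every `M`, every admissible tangent).**  For `s, t > 0` with
`(M+1)·(1 − log((s+t)/s) + 2 log((s+t)/t)) ≥ 2`:
`C₀ + (3 − (M+1)·log((s+t)/t) − log(49/22))·η₀ ≤ δ − φ⁺`. -/
theorem face_gap_coupled {s t : ℝ} (hs : 0 < s) (ht : 0 < t)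
    (hσ : 2 ≤ ((M : ℝ) + 1) * (1 - log ((s + t) / s) + 2 * log ((s + t) / t))) :
    D.C0 + (3 - ((M : ℝ) + 1) * log ((s + t) / t) - log (49 / 22)) * D.η₀ ≤ D.delta - D.phiPlus := by
  obtain ⟨L, hL⟩ : ∃ L : ℝ, L = log ((s + t) / s) := ⟨_, rfl⟩
  obtain ⟨lam, hlam⟩ : ∃ lam : ℝ, lam = log ((s + t) / t) := ⟨_, rfl⟩
  obtain ⟨σv, hσv⟩ : ∃ σv : ℝ, σv = 1 - L + 2 * lam := ⟨_, rfl⟩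
  have hM0 : (0 : ℝ) ≤ M := by positivity
  rw [← hL, ← hlam, ← hσv] at hσ
  rw [← hlam]
  have hσ0 : 0 ≤ σv := by nlinarith
  -- first tail `a`: `3·mOf a − (η₀ − 2a) − g(a) ≥ η₀(2 − λ) − a(2 − σ)` (same tangent `(s,t)`)
  have hga := blockRate_le_tangent D.ha D.two_a_lt hs ht
  rw [← hL, ← hlam] at hga
  have hma := D.mOf_ge D.a
  have hA : 2 * D.η₀ - D.η₀ * lam - 2 * D.a + D.a * σv
      ≤ 3 * D.mOf D.a - (D.η₀ - 2 * D.a) - blockRate D.η₀ D.a := by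
    rw [hσv]; nlinarith [hga, hma]
  -- middle tails: the coupled bound, tail by tail, then summed
  have hmid : ∀ j, D.a * σv - D.η₀ * lam
      ≤ D.mOf (D.mid j) - (D.η₀ - 2 * D.mid j) - blockRate D.η₀ (D.mid j) := by
    intro j
    have hc := coupled_mid D.ha (D.hlo j) (D.two_mid_lt j) hs ht (by rw [← hL, ← hlam, ← hσv]; exact hσ0)
    rw [← hL, ← hlam, ← hσv] at hc
    linarith [D.max_le_mOf (D.mid j)]
  have hS : (M : ℝ) * (D.a * σv - D.η₀ * lam)
      ≤ ∑ j, (D.mOf (D.mid j) - (D.η₀ - 2 * D.mid j) - blockRate D.η₀ (D.mid j)) := by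
    have h := Finset.sum_le_sum fun j (_ : j ∈ (univ : Finset (Fin M))) => hmid j
    rwa [Finset.sum_const, Finset.card_univ, Fintype.card_fin, nsmul_eq_mul] at h
  rw [Finset.sum_sub_distrib, Finset.sum_sub_distrib] at hS
  -- top tail `d`: sharp decoupled tangent
  have hgd := blockRate_add_le_sharp (D.ha.trans D.had) D.hd
  have hmd := D.mOf_ge D.d
  -- the `a`-coefficients combine: `a·((M+1)σ − 2) ≥ 0`
  have hpos : 0 ≤ D.a * ((M + 1) * σv - 2) := mul_nonneg D.ha (by linarith)
  unfold C0 delta phiPlus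
  linarith [hA, hS, hgd, hmd, hpos]

/-- The `M = 5` (`q = 10`) gap constant `3 − 6 log(7/5) − log(49/22)` (float `0.18039`; certified `≥ 0.177`). -/
def gapConst5 : ℝ := 3 - 6 * log (7 / 5) - log (49 / 22)

/-- The `M = 6` (`q = 11`) gap constant `3 − 7 log(49/36) − log(49/22)` (float `0.04111`; certified `≥ 0.0406`). -/
def gapConst6 : ℝ := 3 - 7 * log (49 / 36) - log (49 / 22)

/-- `gapConst5 ≥ 0.177`. -/
theorem gapConst5_ge : (177 / 1000 : ℝ) ≤ gapConst5 := by
  unfold gapConst5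
  linarith [log_seven_fifths_le, log_div_49_22_le]

/-- `gapConst6 ≥ 0.0406` (`= 3 − 7·37/120 − 0.801 = 0.04066…`). -/
theorem gapConst6_ge : (406 / 10000 : ℝ) ≤ gapConst6 := by
  unfold gapConst6
  linarith [log_div_49_36_le, log_div_49_22_le]

/-- **`q = 10` face envelope (PROVED).** `C₀ + (3 − 6 log(7/5) − log(49/22))·η₀ ≤ δ − φ⁺` on the `M = 5` face
(tangent `(2,5)`, constant `0.1804`; the best admissible tangent of the method gives `0.294`, the true face minimum of
`(δ − φ⁺ − C₀)/η₀` is `0.296`, float). -/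
theorem face_gap_five (D : FaceDirM 5) : D.C0 + gapConst5 * D.η₀ ≤ D.delta - D.phiPlus := by
  have h := D.face_gap_coupled (s := 2) (t := 5) (by norm_num) (by norm_num) sigma_two_five
  rw [show ((2 : ℝ) + 5) / 5 = 7 / 5 by norm_num] at h
  unfold gapConst5
  push_cast at h
  linarith

/-- **`q = 11` face envelope (PROVED).** `C₀ + (3 − 7 log(49/36) − log(49/22))·η₀ ≤ δ − φ⁺` on the `M = 6` face
(tangent `(13,36)`; true face minimum of `(δ − φ⁺ − C₀)/η₀` is `0.049`, float). -/
theorem face_gap_six (D : FaceDirM 6) : D.C0 + gapConst6 * D.η₀ ≤ D.delta - D.phiPlus := by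
  have h := D.face_gap_coupled (s := 13) (t := 36) (by norm_num) (by norm_num) sigma_13_36
  rw [show ((13 : ℝ) + 36) / 36 = 49 / 36 by norm_num] at h
  unfold gapConst6
  push_cast at h
  linarith

/-- **UNIFORM FACE ENVELOPE for `M ≤ 6` (`q ≤ 11`; PROVED).** `C₀ + η₀/25 ≤ δ − φ⁺` (`1/25 = 0.04 ≤` each of the
constants `0.7315, 0.4438, 0.1548` (`gapConst`, `M ≤ 4`, gen 5), `0.177` (`M = 5`), `0.0406` (`M = 6`)). -/
theorem face_gap_le_six (hM : M ≤ 6) : D.C0 + D.η₀ / 25 ≤ D.delta - D.phiPlus := by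
  have hη := D.η₀_pos
  rcases Nat.lt_or_ge M 5 with h4 | h5
  · have h4' : M ≤ 4 := by omega
    have hg := D.face_gap
    have hc : (1 / 25 : ℝ) ≤ gapConst M := by
      unfold gapConst
      have h43 := log_four_thirds_le
      have hl2 := Real.log_two_lt_d9
      have hM' : (M : ℝ) ≤ 4 := by exact_mod_cast h4'
      have h43pos : 0 < log (4 / 3 : ℝ) := Real.log_pos (by norm_num)
      have hmul : (M : ℝ) * log (4 / 3) ≤ 4 * log (4 / 3) := mul_le_mul_of_nonneg_right hM' h43pos.le
      norm_num at hl2 ⊢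
      linarith
    nlinarith [mul_le_mul_of_nonneg_right hc hη.le]
  · rcases Nat.lt_or_ge M 6 with h5' | h6
    · obtain rfl : M = 5 := by omega
      nlinarith [D.face_gap_five, mul_le_mul_of_nonneg_right gapConst5_ge hη.le]
    · obtain rfl : M = 6 := by omega
      nlinarith [D.face_gap_six, mul_le_mul_of_nonneg_right gapConst6_ge hη.le]

/-- **NO-GO (PROVED, given the dictionary; `M ≤ 6`, i.e. `q ≤ 11`: windows `{ζ(5)}`, `{ζ(5),ζ(7)}`,
`{ζ(5),ζ(7),ζ(9)}` — every window strictly inside Zudilin's Theorem 3).**  For any `Φ`-saving rate `φ ≤ φ⁺` —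
in particular the true one — `C₀ < δ − φ`: Proposition 5's hypothesis `C₀ > C₂` fails on the whole
numerator-free face, at every height. -/
theorem face_noGo_le_six (hM : M ≤ 6) (φ : ℝ) (hφ : φ ≤ D.phiPlus) : D.C0 < D.delta - φ := by
  have h1 := D.face_gap_le_six hM
  have h2 := D.η₀_pos
  linarith

/-- The net Lemma-19 rate is positive for `M ≤ 6`: `δ − φ − C₀ ≥ η₀/25 > 0` for every `φ ≤ φ⁺` — the integer
multiples `D_{m₁}^3 ⋯ D_{m_{q−3}} Φ⁻¹ F(h)` GROW exponentially on the face (not even "forms → 0" holds). -/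
theorem face_forms_grow_le_six (hM : M ≤ 6) (φ : ℝ) (hφ : φ ≤ D.phiPlus) :
    D.η₀ / 25 ≤ D.delta - φ - D.C0 := by
  linarith [D.face_gap_le_six hM]

/-- The crude Proposition-5 ratio on the face is `< 1` for `M ≤ 6` (float face sups of `C₀/(δ − φ⁺)`:
`0.650 / 0.748 / 0.836 / 0.916 / 0.987` for `q = 7, …, 11`). -/
theorem face_kappa_lt_one_le_six (hM : M ≤ 6) : D.C0 / (D.delta - D.phiPlus) < 1 := by
  have h1 := D.face_noGo_le_six hM D.phiPlus le_rfl
  have hpos : 0 < D.delta - D.phiPlus := by linarith [D.C0_nonneg]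
  rwa [div_lt_one hpos]

/-! ### 4. Kernel instance: a `q = 11` face direction next to the float arg-min shape -/

/-- The `q = 11` (`M = 6`) face direction `(200; 0,0,0, 42, 43,44,45,46,47,48, 71)` (float arg-min of
`(δ − φ⁺ − C₀)/η₀` on this face: `a = mid_j = 0.21η₀`, `d = 0.355η₀`, value `0.049`). -/
def modelFace11 : FaceDirM 6 where
  η₀ := 200
  a := 42
  mid := ![43, 44, 45, 46, 47, 48]
  d := 71
  ha := by norm_num
  hlo := by
    intro j
    fin_cases j <;> simp <;> norm_num
  hhi := by
    intro j
    fin_cases j <;> simp <;> norm_num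
  had := by norm_num
  hd := by norm_num

/-- At that direction: `φ⁺ = 116 + (114+112+110+108+106+104) = 770` and
`δ = 3·158 + (157+156+155+154+153+152) + 129 = 1530` (`m(71) = max{116, 129}`). -/
theorem modelFace11_phiPlus_delta : modelFace11.phiPlus = 770 ∧ modelFace11.delta = 1530 := by
  constructor
  · simp only [phiPlus, modelFace11, Fin.sum_univ_six]
    simp
    norm_num
  · simp only [delta, mOf, modelFace11, Fin.sum_univ_six]
    simp
    norm_num

/-- … so Proposition 5 fails there at every height: `C₀ < 1530 − φ` for all `φ ≤ 770`; in particular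
`C₀ < 760 = δ − φ⁺`. -/
example : modelFace11.C0 < modelFace11.delta - modelFace11.phiPlus :=
  modelFace11.face_noGo_le_six le_rfl _ le_rfl

end FaceDirM

end WellPoisedFace

end Summit.KontsevichZagierPeriods.Zeta5Search
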